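import Summits.NavierStokesRegularity.NavierStokesRegularity.Theorems.TerminalTraceTypeITraceScarL3NoConcentration
import Literature.Analysis.FluidPDE.NSViscosityRescaling
import Literature.Analysis.FluidPDE.NSLerayHopfABCScaling

set_option linter.dupNamespace false

/-!
# Route QuarterJolt — crux `NoTerminalJolt` (stmt-NavierStokesRegularity-26463), LEAD line
# `regular_split`: UNIFORMLY INTEGRABLE ENERGY ⇒ NO LOCAL `L²` CONCENTRATION AT THE TERMINAL TIME

Seat ns-ntj-p1 g5 (LEAD of the crux; `--supports 26463 --as helper`). Stub 3 of the line
(`stub_typeIIEnergyEquality` ⟺ «energy equality at every first blow-up of the frame» ⟺ «every frame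
solution is strongly `L²`-continuous into its terminal time») IMPLIES shelf statement stmt-18118
`HodographBetchov.NoFastEnergyConcentration` (uniform integrability of the kinetic energy over speed
classes up to `T`; landed `noFastEnergyConcentration_of_typeIIEnergyEquality`, p642789). This file proves
the LOCAL CONVERSE:

* `localEnergy_sub_top_le_of_uniformIntegrable_unit` (`ν = 1`) / `localEnergy_sub_top_le_of_uniformIntegrable`
  (every `ν > 0`): `(u,p)` classical on `[0,T)`, Leray–Hopf on `[0,T]`, with UNIFORMLY INTEGRABLE energy
  near `T` — `∀ ε > 0 ∃ l ∀ t ∈ (T₁,T): ∫_{|u(t)| > l} |u(t)|² ≤ ε` (the conclusion of stmt-18118 for this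
  flow, restricted to a final interval) ⇒ for every centre `x₀`, radius `R` and `θ > 0` there is `t₀ < T`
  with `∫_{B(x₀,R)} |u(t) − u(T)|² ≤ θ` for `t ∈ (t₀,T)`;
* `tendsto_localEnergy_sub_top_of_uniformIntegrable` — `∫_{B(x₀,R)} |u(t) − u(T)|² → 0` as `t ↑ T`:
  **a uniformly integrable energy does not concentrate anywhere at the terminal time — the terminal
  value is the STRONG `L²_loc` limit, singular points included.**

PROOF = the tree's CKN-slice route for the Type-I case (`TypeITraceScarL3.localEnergy_sub_top_le_unit`,
nsreg-C26-p1) with its single use of the Type-I MORREY bound replaced by uniform integrability: `Σ_T` is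
closed and `ℋ¹`-null (CKN Theorem B at the top slice, `hausdorffMeasure_topSingularSet_inter_closedBall_eq_zero`,
NO rate hypothesis), so `Σ_T ∩ B̄(x₀,R)` has finite ball covers `U` of small VOLUME (Federer); on `U`,
`∫_U |u(t)|² ≤ l²|U| + ∫_{|u(t)|>l}|u(t)|²` (uniform integrability) and `∫_U |u(T)|²` is small (absolute
continuity); the compact remainder consists of regular top points (`localEnergy_sub_top_le_of_regular_unit`).
General `ν` by Tao's normalisation as in `…NoConcentrationViscosity.lean`.

POSITION: stub 3 ⇒ 18118 ⇒ LOCAL stub 3; the gap between 18118 and stub 3 is TIGHTNESS AT INFINITY of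
`|u(t)|²` as `t ↑ T`. (Energy equality ⟺ no concentration of the energy measure: Leslie–Shvydkoy 2018 §4.)

HONEST FRAMING: a conditional structural statement; nothing here proves stmt-18118, stub 3,
`NoTerminalJolt` or Navier–Stokes regularity — all OPEN; no summit statement is proved here.
[cite: CaffarelliKohnNirenberg1982, Thm B; LeslieShvydkoy2017, Thm. 1.2; Federer1969, 2.10.2]
-/

noncomputable section

open MeasureTheory Set Function Metric Filter Topology Literature.Analysis.FluidPDE
open scoped ENNReal NNReal

namespace Summit.NavierStokesRegularity.NavierStokesRegularity.Theorems.NoTerminalJolt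

open Summit.NavierStokesRegularity.NavierStokesRegularity.Theorems.TypeITraceScarL3

/-- `∫⁻ ‖f‖ₑ²` is finite for an `L²` slice. -/
theorem lintegral_enorm_sq_ne_top_of_memLp {f : EuclideanSpace ℝ (Fin 3) → EuclideanSpace ℝ (Fin 3)}
    (hf : MemLp f 2 volume) : ∫⁻ x, ‖f x‖ₑ ^ 2 ≠ ⊤ := by
  have hint : Integrable (fun x => ‖f x‖ ^ 2) volume := (memLp_two_iff_integrable_sq_norm hf.1).1 hf
  have h : ∫⁻ x, ‖f x‖ₑ ^ 2 = ∫⁻ x, ENNReal.ofReal (‖f x‖ ^ 2) := lintegral_congr fun x => by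
    rw [← ofReal_norm, ENNReal.ofReal_pow (norm_nonneg _)]
  rw [h]
  exact hint.lintegral_lt_top.ne

/-- **UNIFORMLY INTEGRABLE ENERGY ⇒ NO LOCAL `L²` CONCENTRATION AT THE TERMINAL TIME (unit
viscosity).** For `(u,p)` classical on `[0,T)` (`ν = 1`), Leray–Hopf on `[0,T]`, whose kinetic energy is
uniformly integrable over speed classes on a final interval (`∀ ε > 0 ∃ l > 0 ∀ t ∈ (T₁,T):
∫_{|u(t)|>l} |u(t)|² ≤ ε`): for every centre `x₀`, radius `R` and `θ > 0` there is `t₀ < T` with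
`∫_{B(x₀,R)} |u(t) − u(T)|² ≤ θ` for all `t ∈ (t₀,T)`. CKN `ℋ¹`-nullity of the top singular set + Federer
covers of small volume + uniform integrability / absolute continuity on the cover + regular-point
convergence off it. [cite: CaffarelliKohnNirenberg1982, Thm B; Federer1969, 2.10.2; LeslieShvydkoy2017, §4] -/
theorem localEnergy_sub_top_le_of_uniformIntegrable_unit {T : ℝ} (hT : 0 < T)
    {u : ℝ → EuclideanSpace ℝ (Fin 3) → EuclideanSpace ℝ (Fin 3)}
    {p : ℝ → EuclideanSpace ℝ (Fin 3) → ℝ}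
    (hcl : IsClassicalNSSolutionOn (Ico 0 T) 1 0 u p) (hLH : IsLerayHopfOn T 1 0 (u 0) u)
    {T₁ : ℝ} (hT₁T : T₁ < T)
    (hUI : ∀ ε : ℝ, 0 < ε → ∃ l : ℝ, 0 < l ∧ ∀ t ∈ Ioo T₁ T,
      ∫⁻ x in {x | l < ‖u t x‖}, ‖u t x‖ₑ ^ 2 ≤ ENNReal.ofReal ε)
    (x₀ : EuclideanSpace ℝ (Fin 3)) (R : ℝ) {θ : ℝ} (hθ : 0 < θ) :
    ∃ t₀ : ℝ, t₀ < T ∧ ∀ t ∈ Ioo t₀ T,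
      ∫⁻ z in ball x₀ R, ‖u t z - u T z‖ₑ ^ 2 ≤ ENNReal.ofReal θ := by
  classical
  -- ### a final interval of nonnegative times
  set T₂ : ℝ := max T₁ (T / 2) with hT₂
  have hT₂T : T₂ < T := max_lt hT₁T (by linarith)
  have hT₂0 : 0 ≤ T₂ := le_trans (by linarith) (le_max_right _ _)
  -- ### (1) absolute continuity of the terminal energy
  have hmT : MemLp (u T) 2 volume := hLH.memLp T ⟨hT.le, le_rfl⟩
  have hθ8 : ENNReal.ofReal (θ / 8) ≠ 0 := (ENNReal.ofReal_pos.2 (by positivity)).ne'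
  obtain ⟨δT, hδT0, hδT⟩ :=
    exists_pos_setLIntegral_lt_of_measure_lt (lintegral_enorm_sq_ne_top_of_memLp hmT) hθ8
  set δr : ℝ := (min δT 1).toReal with hδr
  have hmin_ne : min δT 1 ≠ ⊤ := ne_top_of_le_ne_top ENNReal.one_ne_top (min_le_right _ _)
  have hδr0 : 0 < δr := ENNReal.toReal_pos (lt_min hδT0 one_pos).ne' hmin_ne
  have hδrle : ENNReal.ofReal δr ≤ δT := by
    rw [hδr, ENNReal.ofReal_toReal hmin_ne]; exact min_le_left _ _
  -- ### (2) the uniform-integrability level for `θ/16`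
  obtain ⟨l, hl0, hl⟩ := hUI (θ / 16) (by positivity)
  -- ### (3) the unit-ball volume as a real number
  obtain ⟨V, hV0, hV⟩ : ∃ V : ℝ, 0 ≤ V ∧
      volume (ball (0 : EuclideanSpace ℝ (Fin 3)) 1) = ENNReal.ofReal V :=
    ⟨_, ENNReal.toReal_nonneg, (ENNReal.ofReal_toReal measure_ball_lt_top.ne).symm⟩
  -- ### (4) the compact `ℋ¹`-null top singular set in the closed ball and its cover of small volume
  set Sing : Set (EuclideanSpace ℝ (Fin 3)) := {x : EuclideanSpace ℝ (Fin 3) |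
    IsBackwardSingularPoint u ((T, x) : ℝ × EuclideanSpace ℝ (Fin 3))} with hSing
  have hKc : IsCompact (Sing ∩ closedBall x₀ R) :=
    (isCompact_closedBall x₀ R).of_isClosed_subset
      ((isClosed_topSingularSet_at u T).inter isClosed_closedBall) inter_subset_right
  have hK0 : μH[1] (Sing ∩ closedBall x₀ R) = 0 :=
    hausdorffMeasure_topSingularSet_inter_closedBall_eq_zero hT hcl hLH x₀ R
  set γr : ℝ := min (δr / (16 * (V + 1))) (θ / (128 * (V + 1) * (l ^ 2 + 1))) with hγr
  have hγr0 : 0 < γr := lt_min (by positivity) (by positivity)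
  have hγr1 : γr ≤ δr / (16 * (V + 1)) := min_le_left _ _
  have hγr2 : γr ≤ θ / (128 * (V + 1) * (l ^ 2 + 1)) := min_le_right _ _
  have hγlt : μH[1] (Sing ∩ closedBall x₀ R) < ENNReal.ofReal γr := by
    rw [hK0]; exact ENNReal.ofReal_pos.2 hγr0
  obtain ⟨S, x, ρ, hρ, hKcov, hsum⟩ :=
    Literature.Geometry.GeometricMeasureTheory.exists_finset_ball_cover_of_hausdorffMeasure_lt
      one_pos hKc hγlt ENNReal.ofReal_ne_top one_pos
  have h4 : (2 : ℝ≥0∞) ^ ((1 : ℝ) + 1) = 4 := by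
    rw [show ((1 : ℝ) + 1) = ((2 : ℕ) : ℝ) by norm_num, ENNReal.rpow_natCast]; norm_num
  have hsum' : ∑ n ∈ S, ENNReal.ofReal (ρ n) ≤ ENNReal.ofReal (8 * γr) := by
    have h1 : ∑ n ∈ S, ENNReal.ofReal (ρ n) = ∑ n ∈ S, ENNReal.ofReal (ρ n) ^ (1 : ℝ) := by
      simp only [ENNReal.rpow_one]
    rw [h1]
    refine hsum.trans (le_of_eq ?_)
    rw [h4, ← mul_assoc, show (4 : ℝ≥0∞) * 2 = ENNReal.ofReal 8 by norm_num,
      ← ENNReal.ofReal_mul (by norm_num)]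
  -- the cover `U` and its volume
  set U : Set (EuclideanSpace ℝ (Fin 3)) := ⋃ n ∈ S, ball (x n) (ρ n) with hU
  have hUvol : volume U ≤ ENNReal.ofReal (8 * γr * V) := by
    calc volume U ≤ ∑ n ∈ S, volume (ball (x n) (ρ n)) := measure_biUnion_finset_le _ _
      _ ≤ ∑ n ∈ S, ENNReal.ofReal (ρ n) * ENNReal.ofReal V := by
          refine Finset.sum_le_sum fun n hn => ?_
          have hρn := hρ n hn
          rw [Measure.addHaar_ball volume (x n) hρn.1.le, finrank_euclideanSpace_fin, hV]
          exact mul_le_mul' (ENNReal.ofReal_le_ofReal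
            (pow_le_of_le_one hρn.1.le hρn.2 (by norm_num))) le_rfl
      _ = (∑ n ∈ S, ENNReal.ofReal (ρ n)) * ENNReal.ofReal V := by rw [Finset.sum_mul]
      _ ≤ ENNReal.ofReal (8 * γr) * ENNReal.ofReal V := mul_le_mul' hsum' le_rfl
      _ = ENNReal.ofReal (8 * γr * V) := (ENNReal.ofReal_mul (by positivity)).symm
  have hUδ : volume U < δT := by
    refine lt_of_lt_of_le (lt_of_le_of_lt hUvol ?_) hδrle
    rw [ENNReal.ofReal_lt_ofReal_iff hδr0]
    have hV1 : 0 < V + 1 := by positivity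
    have h1 : 8 * γr * V ≤ 8 * (δr / (16 * (V + 1))) * V := by nlinarith
    have h2 : 8 * (δr / (16 * (V + 1))) * V = (δr / 2) * (V / (V + 1)) := by
      field_simp
      ring
    have h3 : V / (V + 1) ≤ 1 := by rw [div_le_one hV1]; linarith
    nlinarith [h3, div_nonneg hV0 hV1.le]
  have hUl : ENNReal.ofReal (l ^ 2) * volume U ≤ ENNReal.ofReal (θ / 16) := by
    calc ENNReal.ofReal (l ^ 2) * volume U ≤ ENNReal.ofReal (l ^ 2) * ENNReal.ofReal (8 * γr * V) :=
          mul_le_mul' le_rfl hUvol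
      _ = ENNReal.ofReal (l ^ 2 * (8 * γr * V)) := (ENNReal.ofReal_mul (sq_nonneg _)).symm
      _ ≤ ENNReal.ofReal (θ / 16) := by
          refine ENNReal.ofReal_le_ofReal ?_
          have hV1 : 0 < V + 1 := by positivity
          have hl1 : 0 < l ^ 2 + 1 := by positivity
          have h1 : l ^ 2 * (8 * γr * V) ≤ l ^ 2 * (8 * (θ / (128 * (V + 1) * (l ^ 2 + 1))) * V) := by
            have : 8 * γr * V ≤ 8 * (θ / (128 * (V + 1) * (l ^ 2 + 1))) * V := by nlinarith
            nlinarith [sq_nonneg l]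
          have h2 : l ^ 2 * (8 * (θ / (128 * (V + 1) * (l ^ 2 + 1))) * V) =
              (θ / 16) * ((l ^ 2 / (l ^ 2 + 1)) * (V / (V + 1))) := by
            field_simp
            ring
          have h3 : l ^ 2 / (l ^ 2 + 1) ≤ 1 := by rw [div_le_one hl1]; linarith
          have h4 : V / (V + 1) ≤ 1 := by rw [div_le_one hV1]; linarith
          have h5 : (l ^ 2 / (l ^ 2 + 1)) * (V / (V + 1)) ≤ 1 := by
            calc (l ^ 2 / (l ^ 2 + 1)) * (V / (V + 1)) ≤ 1 * 1 :=
                  mul_le_mul h3 h4 (div_nonneg hV0 hV1.le) zero_le_one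
              _ = 1 := one_mul _
          nlinarith [h5, hθ]
  -- ### (5) energy of `u(t) − u(T)` on the cover: `≤ θ/2`, uniformly for `t ∈ (T₂, T)`
  have hcoverE : ∀ t ∈ Ioo T₂ T, ∫⁻ z in U, ‖u t z - u T z‖ₑ ^ 2 ≤ ENNReal.ofReal (θ / 2) := by
    intro t ht
    have ht1 : t ∈ Ioo T₁ T := ⟨(le_max_left _ _).trans_lt ht.1, ht.2⟩
    have htIco : t ∈ Ico 0 T := ⟨hT₂0.trans ht.1.le, ht.2⟩
    have hcont : Continuous (u t) := (hcl.contDiff_velocity htIco).continuous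
    -- (a) uniform integrability on the cover
    have hmeasL : MeasurableSet {z : EuclideanSpace ℝ (Fin 3) | l < ‖u t z‖} :=
      (isOpen_lt continuous_const hcont.norm).measurableSet
    have hsplit : ∫⁻ z in U, ‖u t z‖ₑ ^ 2 ≤
        ENNReal.ofReal (l ^ 2) * volume U + ∫⁻ z in {z | l < ‖u t z‖}, ‖u t z‖ₑ ^ 2 := by
      have hpt : ∀ z, ‖u t z‖ₑ ^ 2 ≤ ENNReal.ofReal (l ^ 2) +
          ({z : EuclideanSpace ℝ (Fin 3) | l < ‖u t z‖}.indicator (fun z => ‖u t z‖ₑ ^ 2)) z := by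
        intro z
        by_cases hz : l < ‖u t z‖
        · rw [indicator_of_mem (show z ∈ {z : EuclideanSpace ℝ (Fin 3) | l < ‖u t z‖} from hz)]
          exact le_add_self
        · rw [indicator_of_notMem (show z ∉ {z : EuclideanSpace ℝ (Fin 3) | l < ‖u t z‖} from hz),
            add_zero]
          rw [not_lt] at hz
          calc ‖u t z‖ₑ ^ 2 = ENNReal.ofReal (‖u t z‖ ^ 2) := by
                rw [← ofReal_norm, ENNReal.ofReal_pow (norm_nonneg _)]
            _ ≤ ENNReal.ofReal (l ^ 2) :=
                ENNReal.ofReal_le_ofReal (pow_le_pow_left₀ (norm_nonneg _) hz 2)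
      calc ∫⁻ z in U, ‖u t z‖ₑ ^ 2
          ≤ ∫⁻ z in U, (ENNReal.ofReal (l ^ 2) +
              {z : EuclideanSpace ℝ (Fin 3) | l < ‖u t z‖}.indicator (fun z => ‖u t z‖ₑ ^ 2) z) :=
            lintegral_mono fun z => hpt z
        _ = ENNReal.ofReal (l ^ 2) * volume U +
              ∫⁻ z in U, {z : EuclideanSpace ℝ (Fin 3) | l < ‖u t z‖}.indicator
                (fun z => ‖u t z‖ₑ ^ 2) z := by
            rw [lintegral_add_left measurable_const, setLIntegral_const]
        _ ≤ ENNReal.ofReal (l ^ 2) * volume U +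
              ∫⁻ z, {z : EuclideanSpace ℝ (Fin 3) | l < ‖u t z‖}.indicator
                (fun z => ‖u t z‖ₑ ^ 2) z :=
            add_le_add le_rfl (setLIntegral_le_lintegral _ _)
        _ = ENNReal.ofReal (l ^ 2) * volume U + ∫⁻ z in {z | l < ‖u t z‖}, ‖u t z‖ₑ ^ 2 := by
            rw [lintegral_indicator hmeasL]
    have hUt : ∫⁻ z in U, ‖u t z‖ₑ ^ 2 ≤ ENNReal.ofReal (θ / 16) + ENNReal.ofReal (θ / 16) :=
      hsplit.trans (add_le_add hUl (hl t ht1))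
    -- (b) absolute continuity of the terminal energy on the cover
    have hUT : ∫⁻ z in U, ‖u T z‖ₑ ^ 2 ≤ ENNReal.ofReal (θ / 8) := (hδT U hUδ).le
    -- (c) combine
    have hmeas2 : AEMeasurable (fun z => 2 * ‖u t z‖ₑ ^ 2) (volume.restrict U) :=
      (((hcont.aestronglyMeasurable.aemeasurable.enorm.pow_const 2).const_mul 2)).restrict
    calc ∫⁻ z in U, ‖u t z - u T z‖ₑ ^ 2
        ≤ ∫⁻ z in U, (2 * ‖u t z‖ₑ ^ 2 + 2 * ‖u T z‖ₑ ^ 2) :=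
          lintegral_mono fun z => TypeITraceScarL3.enorm_sub_sq_le _ _
      _ = (2 * ∫⁻ z in U, ‖u t z‖ₑ ^ 2) + 2 * ∫⁻ z in U, ‖u T z‖ₑ ^ 2 := by
          rw [lintegral_add_left' hmeas2, lintegral_const_mul' _ _ ENNReal.ofNat_ne_top,
            lintegral_const_mul' _ _ ENNReal.ofNat_ne_top]
      _ ≤ 2 * (ENNReal.ofReal (θ / 16) + ENNReal.ofReal (θ / 16)) + 2 * ENNReal.ofReal (θ / 8) := by
          gcongr
      _ = ENNReal.ofReal (θ / 2) := by
          rw [← ENNReal.ofReal_add (by positivity) (by positivity),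
            show (2 : ℝ≥0∞) = ENNReal.ofReal 2 by norm_num, ← ENNReal.ofReal_mul (by norm_num),
            ← ENNReal.ofReal_mul (by norm_num), ← ENNReal.ofReal_add (by positivity) (by positivity)]
          congr 1
          ring
  -- ### (6) the compact regular remainder and its finite cover by regular balls
  have hOo : IsOpen U := isOpen_biUnion fun _ _ => isOpen_ball
  have hK'c : IsCompact (closedBall x₀ R \ U) := (isCompact_closedBall _ _).diff hOo
  have hreg : ∀ y ∈ closedBall x₀ R \ U,
      ∃ r : ℝ, 0 < r ∧ ∀ θ' : ℝ, 0 < θ' → ∃ t₀ : ℝ, t₀ < T ∧ ∀ t ∈ Ioo t₀ T,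
        ∫⁻ z in ball y r, ‖u t z - u T z‖ₑ ^ 2 ≤ ENNReal.ofReal θ' := by
    rintro y ⟨hyR, hyO⟩
    refine localEnergy_sub_top_le_of_regular_unit hT hcl hLH fun hsing => ?_
    exact hyO (hKcov ⟨hsing, hyR⟩)
  choose! rr hrr hθy using hreg
  obtain ⟨Tf, hTsub, hTcov⟩ : ∃ Tf : Finset (EuclideanSpace ℝ (Fin 3)),
      (↑Tf : Set (EuclideanSpace ℝ (Fin 3))) ⊆ closedBall x₀ R \ U ∧
      closedBall x₀ R \ U ⊆ ⋃ y ∈ Tf, ball y (rr y) := by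
    obtain ⟨b', hb'sub, hb'fin, hb'cov⟩ := hK'c.elim_finite_subcover_image
      (b := closedBall x₀ R \ U)
      (c := fun y => ball y (rr y)) (fun _ _ => isOpen_ball)
      (fun y hy => mem_biUnion hy (mem_ball_self (hrr y hy)))
    refine ⟨hb'fin.toFinset, by rwa [Set.Finite.coe_toFinset], ?_⟩
    simpa only [Set.Finite.mem_toFinset] using hb'cov
  have hθ₁pos : 0 < θ / (2 * ((Tf.card : ℝ) + 1)) := by positivity
  obtain ⟨t₂, ht₂, hRegular⟩ : ∃ t₂ : ℝ, t₂ < T ∧ ∀ t ∈ Ioo t₂ T, ∀ y ∈ Tf,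
      ∫⁻ z in ball y (rr y), ‖u t z - u T z‖ₑ ^ 2 ≤ ENNReal.ofReal (θ / (2 * ((Tf.card : ℝ) + 1))) :=
    exists_lt_forall_Ioo_finset Tf fun y hy => hθy y (hTsub hy) _ hθ₁pos
  refine ⟨max T₂ t₂, max_lt hT₂T ht₂, fun t ht => ?_⟩
  have htT₂ : t ∈ Ioo T₂ T := ⟨(le_max_left _ _).trans_lt ht.1, ht.2⟩
  have htt₂ : t ∈ Ioo t₂ T := ⟨(le_max_right _ _).trans_lt ht.1, ht.2⟩
  -- ### assemble
  have hballsub : ball x₀ R ⊆ U ∪ ⋃ y ∈ Tf, ball y (rr y) := by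
    intro z hz
    by_cases hzO : z ∈ U
    · exact Or.inl hzO
    · exact Or.inr (hTcov ⟨ball_subset_closedBall hz, hzO⟩)
  have hcard : (Tf.card : ℝ≥0∞) * ENNReal.ofReal (θ / (2 * ((Tf.card : ℝ) + 1))) ≤
      ENNReal.ofReal (θ / 2) := by
    rw [← ENNReal.ofReal_natCast, ← ENNReal.ofReal_mul (Nat.cast_nonneg _)]
    refine ENNReal.ofReal_le_ofReal ?_
    have h2 : 0 < 2 * ((Tf.card : ℝ) + 1) := by positivity
    rw [← mul_div_assoc, div_le_iff₀ h2]
    nlinarith [hθ, Nat.cast_nonneg (α := ℝ) Tf.card]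
  calc ∫⁻ z in ball x₀ R, ‖u t z - u T z‖ₑ ^ 2
      ≤ ∫⁻ z in U ∪ ⋃ y ∈ Tf, ball y (rr y), ‖u t z - u T z‖ₑ ^ 2 := lintegral_mono_set hballsub
    _ ≤ (∫⁻ z in U, ‖u t z - u T z‖ₑ ^ 2) +
          ∫⁻ z in ⋃ y ∈ Tf, ball y (rr y), ‖u t z - u T z‖ₑ ^ 2 := lintegral_union_le _ _ _
    _ ≤ ENNReal.ofReal (θ / 2) + ∑ y ∈ Tf, ∫⁻ z in ball y (rr y), ‖u t z - u T z‖ₑ ^ 2 :=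
        add_le_add (hcoverE t htT₂) (lintegral_biUnion_finset_le _ _ _ _)
    _ ≤ ENNReal.ofReal (θ / 2) + ∑ _y ∈ Tf, ENNReal.ofReal (θ / (2 * ((Tf.card : ℝ) + 1))) :=
        add_le_add le_rfl (Finset.sum_le_sum (hRegular t htt₂))
    _ = ENNReal.ofReal (θ / 2) + (Tf.card : ℝ≥0∞) * ENNReal.ofReal (θ / (2 * ((Tf.card : ℝ) + 1))) := by
        rw [Finset.sum_const, nsmul_eq_mul]
    _ ≤ ENNReal.ofReal (θ / 2) + ENNReal.ofReal (θ / 2) := add_le_add le_rfl hcard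
    _ = ENNReal.ofReal θ := by
        rw [← ENNReal.ofReal_add (by positivity) (by positivity), add_halves]

/-- **Uniformly integrable energy ⇒ no local `L²` concentration at the terminal time, every viscosity**:
`(u,p)` classical on `[0,T)` with viscosity `ν > 0`, Leray–Hopf on `[0,T]`, energy uniformly integrable
over speed classes on a final interval `(T₁,T)` ⇒ `∀ x₀ R θ>0 ∃ t₀<T ∀ t ∈ (t₀,T),
∫_{B(x₀,R)} |u(t) − u(T)|² ≤ θ`. Tao's normalisation `v(s,x) = ν⁻¹u(s/ν,x)` (uniform integrability is
transported with the level `ν⁻¹l`) and the unit theorem. [cite: Tao2011, footnote 3; CaffarelliKohnNirenberg1982, Thm B] -/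
theorem localEnergy_sub_top_le_of_uniformIntegrable {ν T : ℝ} (hν : 0 < ν) (hT : 0 < T)
    {u : ℝ → EuclideanSpace ℝ (Fin 3) → EuclideanSpace ℝ (Fin 3)}
    {p : ℝ → EuclideanSpace ℝ (Fin 3) → ℝ}
    (hcl : IsClassicalNSSolutionOn (Set.Ico 0 T) ν 0 u p) (hLH : IsLerayHopfOn T ν 0 (u 0) u)
    {T₁ : ℝ} (hT₁T : T₁ < T)
    (hUI : ∀ ε : ℝ, 0 < ε → ∃ l : ℝ, 0 < l ∧ ∀ t ∈ Ioo T₁ T,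
      ∫⁻ x in {x | l < ‖u t x‖}, ‖u t x‖ₑ ^ 2 ≤ ENNReal.ofReal ε)
    (x₀ : EuclideanSpace ℝ (Fin 3)) (R : ℝ) {θ : ℝ} (hθ : 0 < θ) :
    ∃ t₀ : ℝ, t₀ < T ∧ ∀ t ∈ Ioo t₀ T,
      ∫⁻ z in ball x₀ R, ‖u t z - u T z‖ₑ ^ 2 ≤ ENNReal.ofReal θ := by
  have hν0 : ν ≠ 0 := hν.ne'
  have hνi : 0 < ν⁻¹ := inv_pos.2 hν
  have hνT : 0 < ν * T := mul_pos hν hT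
  -- viscosity normalisation `v(s, x) = ν⁻¹ u(s/ν, x)`, terminal time `νT`
  set v : ℝ → EuclideanSpace ℝ (Fin 3) → EuclideanSpace ℝ (Fin 3) := timeRescale ν⁻¹ ν⁻¹ u with hv
  set pv : ℝ → EuclideanSpace ℝ (Fin 3) → ℝ := timeRescale ν⁻¹ (ν⁻¹ ^ 2) p with hpv
  have hmaps : MapsTo (fun s => ν⁻¹ * s) (Ico 0 (ν * T)) (Ico 0 T) := by
    intro s hs
    refine ⟨mul_nonneg hνi.le hs.1, ?_⟩
    calc ν⁻¹ * s < ν⁻¹ * (ν * T) := mul_lt_mul_of_pos_left hs.2 hνi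
      _ = T := by rw [← mul_assoc, inv_mul_cancel₀ hν0, one_mul]
  have hclv : IsClassicalNSSolutionOn (Ico 0 (ν * T)) 1 0 v pv := by
    have h := hcl.viscosityRescale_set hν0 hmaps (uniqueDiffOn_Ico 0 (ν * T))
    rwa [timeRescale_zero_force] at h
  have hv0 : ν⁻¹ • u 0 = v 0 := by
    funext x
    simp [hv]
  have hLHv : IsLerayHopfOn (ν * T) 1 0 (v 0) v := by
    have h := hLH.viscosityRescale hνi
    have e1 : T / ν⁻¹ = ν * T := by rw [div_inv_eq_mul, mul_comm]
    rwa [e1, inv_mul_cancel₀ hν0, timeRescale_zero_force, hv0] at h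
  have e0 : ν⁻¹ * (ν * T) = T := by rw [← mul_assoc, inv_mul_cancel₀ hν0, one_mul]
  -- uniform integrability is transported (level `ν⁻¹ l`, tolerance `ν⁻² ε`)
  have hT₁v : ν * T₁ < ν * T := mul_lt_mul_of_pos_left hT₁T hν
  have hUIv : ∀ ε : ℝ, 0 < ε → ∃ l : ℝ, 0 < l ∧ ∀ s ∈ Ioo (ν * T₁) (ν * T),
      ∫⁻ x in {x | l < ‖v s x‖}, ‖v s x‖ₑ ^ 2 ≤ ENNReal.ofReal ε := by
    intro ε hε
    obtain ⟨l, hl0, hl⟩ := hUI (ν ^ 2 * ε) (by positivity)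
    refine ⟨ν⁻¹ * l, by positivity, fun s hs => ?_⟩
    have ht : ν⁻¹ * s ∈ Ioo T₁ T := by
      constructor
      · have h := mul_lt_mul_of_pos_left hs.1 hνi
        rwa [← mul_assoc, inv_mul_cancel₀ hν0, one_mul] at h
      · have h := mul_lt_mul_of_pos_left hs.2 hνi
        rwa [e0] at h
    have hnorm : ∀ x, ‖v s x‖ = ν⁻¹ * ‖u (ν⁻¹ * s) x‖ := fun x => by
      rw [hv, timeRescale_apply, norm_smul, Real.norm_eq_abs, abs_of_pos hνi]
    have hset : {x : EuclideanSpace ℝ (Fin 3) | ν⁻¹ * l < ‖v s x‖} =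
        {x | l < ‖u (ν⁻¹ * s) x‖} := by
      ext x
      simp only [mem_setOf_eq, hnorm x]
      exact ⟨fun h => lt_of_mul_lt_mul_left h hνi.le, fun h => mul_lt_mul_of_pos_left h hνi⟩
    have hfun : (fun x => ‖v s x‖ₑ ^ 2) = fun x => ‖ν⁻¹ • u (ν⁻¹ * s) x‖ₑ ^ 2 := by
      funext x
      rw [hv, timeRescale_apply]
    rw [hset, hfun, lintegral_enorm_sq_const_smul]
    calc ENNReal.ofReal (ν⁻¹ ^ 2) * ∫⁻ x in {x | l < ‖u (ν⁻¹ * s) x‖}, ‖u (ν⁻¹ * s) x‖ₑ ^ 2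
        ≤ ENNReal.ofReal (ν⁻¹ ^ 2) * ENNReal.ofReal (ν ^ 2 * ε) :=
          mul_le_mul' le_rfl (hl _ ht)
      _ = ENNReal.ofReal ε := by
          rw [← ENNReal.ofReal_mul (sq_nonneg _)]
          congr 1
          field_simp
  -- the unit theorem for `v` at time `νT` with tolerance `ν⁻² θ`
  have hθ' : 0 < ν⁻¹ ^ 2 * θ := by positivity
  obtain ⟨s₀, hs₀, hunit⟩ :=
    localEnergy_sub_top_le_of_uniformIntegrable_unit hνT hclv hLHv hT₁v hUIv x₀ R hθ'
  refine ⟨ν⁻¹ * s₀, by nlinarith, fun t ht => ?_⟩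
  -- `s = νt ∈ (s₀, νT)`
  have hs : ν * t ∈ Ioo s₀ (ν * T) := by
    constructor
    · have h := mul_lt_mul_of_pos_left ht.1 hν
      rwa [← mul_assoc, mul_inv_cancel₀ hν0, one_mul] at h
    · exact mul_lt_mul_of_pos_left ht.2 hν
  have key := hunit (ν * t) hs
  -- `v(νt) − v(νT) = ν⁻¹ (u(t) − u(T))`
  have e1 : (fun z => ‖v (ν * t) z - v (ν * T) z‖ₑ ^ 2) =
      fun z => ‖ν⁻¹ • (u t z - u T z)‖ₑ ^ 2 := by
    funext z
    rw [hv, timeRescale_apply, timeRescale_apply, ← mul_assoc, inv_mul_cancel₀ hν0, one_mul, e0,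
      smul_sub]
  rw [e1, lintegral_enorm_sq_const_smul, ENNReal.ofReal_mul (sq_nonneg _)] at key
  have hne0 : ENNReal.ofReal (ν⁻¹ ^ 2) ≠ 0 := by
    rw [ne_eq, ENNReal.ofReal_eq_zero, not_le]; positivity
  exact (ENNReal.mul_le_mul_iff_right hne0 ENNReal.ofReal_ne_top).1 key

/-- **UNIFORMLY INTEGRABLE ENERGY ⇒ THE TERMINAL VALUE IS THE STRONG `L²_loc` LIMIT** (`Tendsto`
form): for `(u,p)` classical on `[0,T)` with viscosity `ν > 0`, Leray–Hopf on `[0,T]`, with energy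
uniformly integrable over speed classes on a final interval, `∫_{B(x₀,R)} |u(t) − u(T)|² → 0` as `t ↑ T`,
for EVERY centre `x₀` (singular points included) and radius `R`. [cite: CaffarelliKohnNirenberg1982, Thm B; LeslieShvydkoy2017, §4] -/
theorem tendsto_localEnergy_sub_top_of_uniformIntegrable {ν T : ℝ} (hν : 0 < ν) (hT : 0 < T)
    {u : ℝ → EuclideanSpace ℝ (Fin 3) → EuclideanSpace ℝ (Fin 3)}
    {p : ℝ → EuclideanSpace ℝ (Fin 3) → ℝ}
    (hcl : IsClassicalNSSolutionOn (Set.Ico 0 T) ν 0 u p) (hLH : IsLerayHopfOn T ν 0 (u 0) u)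
    {T₁ : ℝ} (hT₁T : T₁ < T)
    (hUI : ∀ ε : ℝ, 0 < ε → ∃ l : ℝ, 0 < l ∧ ∀ t ∈ Ioo T₁ T,
      ∫⁻ x in {x | l < ‖u t x‖}, ‖u t x‖ₑ ^ 2 ≤ ENNReal.ofReal ε)
    (x₀ : EuclideanSpace ℝ (Fin 3)) (R : ℝ) :
    Tendsto (fun t => ∫⁻ z in ball x₀ R, ‖u t z - u T z‖ₑ ^ 2) (𝓝[<] T) (𝓝 0) := by
  rw [ENNReal.tendsto_nhds_zero]
  intro ε hε
  rcases eq_or_ne ε ⊤ with rfl | hεtop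
  · exact Eventually.of_forall fun _ => le_top
  obtain ⟨t₀, ht₀, h⟩ := localEnergy_sub_top_le_of_uniformIntegrable hν hT hcl hLH hT₁T hUI x₀ R
    (ENNReal.toReal_pos hε.ne' hεtop)
  rw [← nhdsWithin_Ioo_eq_nhdsLT ht₀]
  filter_upwards [self_mem_nhdsWithin] with t ht
  exact (h t ht).trans (ENNReal.ofReal_toReal hεtop).le

end Summit.NavierStokesRegularity.NavierStokesRegularity.Theorems.NoTerminalJolt

end
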